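import Mathlib.RingTheory.SimpleModule.Isotypic
import Mathlib.RepresentationTheory.Basic

/-!
# An isotypic component inherits every identity `r • w = w` of its type

Kernel witness (cell pub-hodge-repro2, seat p5, Tier 5) for the last clause of
route/T5-N4-p5.md v12 (A3) STEP 6 (l. 147):

> «ρ_f is trivial on an open normal subgroup K′_f; so the ρ-isotypic part M(ρ) is contained in
> π₀^{K′_f}[…]»,

in its module-theoretic form: if `W` is a simple submodule of an `R`-module `M` and a scalar
`r : R` acts as the identity on `W`, then `r` acts as the identity on the whole `S`-isotypic
component `isotypicComponent R M W` (the sum of all submodules isomorphic to `W`) —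
`smul_eq_self_of_mem_isotypicComponent`.  Applied with `R = k[K]`, `r = single k′ 1` for
`k′ ∈ K′_f` (a group element acting trivially on the type `ρ`), every vector of the `ρ`-isotypic
part of a representation is `K′_f`-fixed (`apply_eq_self_of_mem_isotypicComponent`).

Mathlib only; the representation `π₀`, the compactness of `K` and the finiteness of
`π₀^{K′_f}[ρ_∞]` (STEP 5) stay prose in (A3).
-/

open scoped MonoidAlgebra

namespace Summit.Ventures.HodgeRepro2.T5IsotypicFixed

section Module

variable {R M : Type*} [Ring R] [AddCommGroup M] [Module R M]

/-- If `r` acts as the identity on `W` and `m ≃ₗ[R] W`, then `r` acts as the identity on `m`. -/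
theorem smul_eq_self_of_linearEquiv {W m : Submodule R M} (e : m ≃ₗ[R] W) {r : R}
    (hr : ∀ w : W, r • w = w) (x : m) : r • x = x := by
  apply e.injective
  rw [map_smul, hr]

/-- If `r : R` acts as the identity on the submodule `W`, it acts as the identity on every element
of the `W`-isotypic component of `M`. -/
theorem smul_eq_self_of_mem_isotypicComponent (W : Submodule R M) {r : R}
    (hr : ∀ w : W, r • w = w) {x : M} (hx : x ∈ isotypicComponent R M W) : r • x = x := by
  rw [isotypicComponent, sSup_eq_iSup'] at hx
  refine Submodule.iSup_induction (motive := fun y => r • y = y) _ hx ?_ (smul_zero r) ?_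
  · rintro ⟨m, ⟨e⟩⟩ y hy
    have h := smul_eq_self_of_linearEquiv e hr ⟨y, hy⟩
    exact congrArg Subtype.val h
  · intro y z hy hz
    rw [smul_add, hy, hz]

/-- The `W`-isotypic component lies in the fixed points of every `r` acting trivially on `W`. -/
theorem isotypicComponent_le_fixed (W : Submodule R M) {r : R} (hr : ∀ w : W, r • w = w) :
    ∀ x ∈ isotypicComponent R M W, r • x = x :=
  fun _ hx => smul_eq_self_of_mem_isotypicComponent W hr hx

end Module

section Representation

variable {k G V : Type*} [Field k] [Monoid G] [AddCommGroup V] [Module k V]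
  (ρ : Representation k G V)

/-- Representation form: if `g` acts trivially on the `k[G]`-submodule `W` of `ρ.asModule`, then
`ρ g` fixes every vector of the `W`-isotypic component. -/
theorem apply_eq_self_of_mem_isotypicComponent (W : Submodule k[G] ρ.asModule) (g : G)
    (hg : ∀ w : W, ρ g (w : ρ.asModule) = (w : ρ.asModule)) {x : ρ.asModule}
    (hx : x ∈ isotypicComponent k[G] ρ.asModule W) : ρ g x = x := by
  have hr : ∀ w : W, (MonoidAlgebra.single g (1 : k)) • w = w := by
    intro w
    apply Subtype.ext
    change (MonoidAlgebra.single g (1 : k)) • (w : ρ.asModule) = (w : ρ.asModule)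
    rw [Representation.single_smul, one_smul]
    exact hg w
  have h := smul_eq_self_of_mem_isotypicComponent W hr hx
  rw [Representation.single_smul, one_smul] at h
  exact h

/-- The same for a set `K′` of group elements acting trivially on `W` (e.g. an open normal
subgroup on which `ρ_f` is trivial): the isotypic component consists of `K′`-fixed vectors. -/
theorem apply_eq_self_of_mem_isotypicComponent_of_forall (W : Submodule k[G] ρ.asModule)
    (K' : Set G) (hK' : ∀ g ∈ K', ∀ w : W, ρ g (w : ρ.asModule) = (w : ρ.asModule)) {x : ρ.asModule}
    (hx : x ∈ isotypicComponent k[G] ρ.asModule W) : ∀ g ∈ K', ρ g x = x :=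
  fun g hg => apply_eq_self_of_mem_isotypicComponent ρ W g (hK' g hg) hx

end Representation

end Summit.Ventures.HodgeRepro2.T5IsotypicFixed
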